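import Mathlib
import Literature.MathematicalPhysics.QuantumLattice.ScaleCutoffs
import Literature.MathematicalPhysics.QuantumLattice.FermiRG.BGM2006Sec2Setup
import Literature.MathematicalPhysics.QuantumLattice.HubbardBandSectorCountingBounds
import HarnessLib

/-!
# Route `KLProgramme` — crux K3 `KLRegimeTwoPointLimit` (stmt-HubbardSuperconductivity-19937), support:
# support and size of BGM's free single-scale propagator — the bridge from the typed propagators
# (t1's `FermiRG.bgmSingleScale`) to Lemma E.1/E.3's two-shell sets (E1-NOTE §2 Corollary, §8.2)

Cell `gate-hubbard-kl`, seat p1b. Lemma E.1/E.3 (`kltb_exists_twoShell_bound`) bounds the planar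
measure of the two-shell set `{|ε(k) - μ| < ε₁, |ε(k - w) - μ| ≤ ε₂}`; the Corollary of E1-NOTE §2
(the single-scale particle–particle / particle–hole bubble `∫|g^{(j)}(k) g^{(j′)}(q - k)|dk`) needs,
besides that measure, only two facts about the single-scale propagator `ĝ^{(h)} = f_h/(-ik₀ + E_{h-1} - μ)`
of BGM 2006 (2.27)–(2.28) with the FREE (scale-independent) dispersion family `E_h ≡ ε`:

* `klps_shell_of_singleScale_ne_zero` — SUPPORT: `ĝ^{(h)}(k₀, k⃗) ≠ 0` forces
  `e₀γ^{h-2} < ‖-ik₀ + ε(k⃗) - μ‖ < e₀γ^h`, hence `|ε(k⃗) - μ| < e₀γ^h` and `|k₀| < e₀γ^h`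
  (`mem_Ioo_of_gnShell_ne_zero`; `γ = 4`);
* `klps_norm_singleScale_le` — SIZE: `‖ĝ^{(h)}(k)‖ ≤ (e₀γ^{h-2})⁻¹ = γ²·γ^{-h}/e₀` everywhere
  (`0 ≤ f_h ≤ 1` on the support);
* `klps_bubble_pointwise` — hence for the pp bubble at transfer `q⃗` (or the ph bubble at `-q⃗`):
  `‖ĝ^{(h)}(k₀, k⃗) ĝ^{(h′)}(k₀′, q⃗ - k⃗)‖ ≤ (e₀γ^{h-2})⁻¹(e₀γ^{h′-2})⁻¹`, and the product VANISHES unless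
  `|ε(k⃗) - μ| < e₀γ^h` and `|ε(q⃗ - k⃗) - μ| < e₀γ^{h′}` — i.e. unless `k⃗` lies in the two-shell set of
  Lemma E.1 with `(ε₁, ε₂) = (e₀γ^h, e₀γ^{h′})` and `w = q⃗` (`ε` is even, so `ε(k⃗ - q⃗) = ε(q⃗ - k⃗)`).
Integrating the pointwise bound against the two-shell measure (after the routine transport
`(Fin 2 → ℝ) ≃ ℝ × ℝ` and the Matsubara count `#{|k₀| < e₀γ^h} ≤ βe₀γ^h/π + 1`) gives the Corollary's
`∫|g^{(h)}g^{(h′)}| ≤ C min{γ^{h-h′}, γ^{h}/|q|_𝕋 + γ^{h}·γ^{-h′/2}}` with the constants of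
`kltb_exists_twoShell_bound`; that last assembly is left to the consumer (child 1's typing fixes the
carrier). The dispersion family is taken as a HYPOTHESIS `∀ h p, E h p = ε(p⃗)` (no new definition):
it covers t1's `BGMInitial` at `h = 0` and the frame-free (`K = 0`) case of the CT scheme.
-/

noncomputable section

-- the tree's namespace `Summit.<Summit>.<Problem>.Theorems` repeats the summit name by design (D-0017)
set_option linter.dupNamespace false

open Real Set
open Literature.MathematicalPhysics.QuantumLattice
open Literature.MathematicalPhysics.QuantumLattice.FermiRG
open Literature.MathematicalPhysics.QuantumLattice.BandSectorCounting

namespace Summit.HubbardSuperconductivity.HubbardSuperconductivity.Theorems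

section Main

variable {e₀ μ : ℝ} (he₀ : 0 < e₀) {E : ℤ → ℝ × (Fin 2 → ℝ) → ℂ}
  (hE : ∀ (h : ℤ) (p : ℝ × (Fin 2 → ℝ)), E h p = ((sqDispersion p.2 : ℝ) : ℂ))
include he₀ hE

omit he₀ in
/-- For the free family the scale-`h` denominator is `-ik₀ + (ε(k⃗) - μ)`: its real part is `ε(k⃗) - μ`
and its imaginary part is `-k₀`. -/
theorem klps_denom_re_im (h : ℤ) (p : ℝ × (Fin 2 → ℝ)) :
    (bgmDenom μ E h p).re = sqDispersion p.2 - μ ∧ (bgmDenom μ E h p).im = -p.1 := by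
  constructor
  · simp [bgmDenom, hE]
  · simp [bgmDenom, hE]

omit he₀ in
/-- The denominator does not depend on the scale for the free family. -/
theorem klps_denom_eq (h h' : ℤ) (p : ℝ × (Fin 2 → ℝ)) : bgmDenom μ E h p = bgmDenom μ E h' p := by
  simp [bgmDenom, hE]

omit he₀ in
/-- `|ε(k⃗) - μ| ≤ ‖-ik₀ + ε(k⃗) - μ‖` and `|k₀| ≤ ‖-ik₀ + ε(k⃗) - μ‖`. -/
theorem klps_abs_le_norm_denom (h : ℤ) (p : ℝ × (Fin 2 → ℝ)) :
    |sqDispersion p.2 - μ| ≤ ‖bgmDenom μ E h p‖ ∧ |p.1| ≤ ‖bgmDenom μ E h p‖ := by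
  obtain ⟨hre, him⟩ := klps_denom_re_im hE h p
  constructor
  · have := Complex.abs_re_le_norm (bgmDenom μ E h p)
    rwa [hre] at this
  · have := Complex.abs_im_le_norm (bgmDenom μ E h p)
    rwa [him, abs_neg] at this

omit he₀ in
/-- For the free family BGM's two-dispersion shell function (2.28) IS the tree's `gnShell` at the
norm of the denominator. -/
theorem klps_shell_eq (h : ℤ) (p : ℝ × (Fin 2 → ℝ)) :
    bgmShell e₀ μ E h p = gnShell 4 e₀ h ‖bgmDenom μ E h p‖ := by
  rw [bgmShell, bgmCutoffInv, bgmCutoffInv, gnShell, klps_denom_eq hE (h - 1) h p]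

/-- **Support of the free single-scale propagator.** If `ĝ^{(h)}(k₀, k⃗) ≠ 0` then
`e₀ 4^{h-2} < ‖-ik₀ + ε(k⃗) - μ‖ < e₀ 4^h`, hence `|ε(k⃗) - μ| < e₀ 4^h` and `|k₀| < e₀ 4^h`:
the spatial momentum lies in the shell of width `e₀γ^h` around the Fermi curve `{ε = μ}`. -/
theorem klps_shell_of_singleScale_ne_zero {h : ℤ} {p : ℝ × (Fin 2 → ℝ)}
    (hp : bgmSingleScale e₀ μ E h p ≠ 0) :
    e₀ * (4 : ℝ) ^ (h - 2) < ‖bgmDenom μ E h p‖ ∧ ‖bgmDenom μ E h p‖ < e₀ * (4 : ℝ) ^ h ∧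
      |sqDispersion p.2 - μ| < e₀ * (4 : ℝ) ^ h ∧ |p.1| < e₀ * (4 : ℝ) ^ h := by
  have hshell : bgmShell e₀ μ E h p ≠ 0 := by
    intro h0
    apply hp
    rw [bgmSingleScale, h0]
    simp
  rw [klps_shell_eq hE] at hshell
  have hmem := mem_Ioo_of_gnShell_ne_zero (by norm_num : (1 : ℝ) < 4) he₀ hshell
  obtain ⟨h1, h2⟩ := klps_abs_le_norm_denom hE h p
  exact ⟨hmem.1, hmem.2, h1.trans_lt hmem.2, h2.trans_lt hmem.2⟩

/-- **Size of the free single-scale propagator**: `‖ĝ^{(h)}(k)‖ ≤ (e₀ 4^{h-2})⁻¹ = 16·4^{-h}/e₀`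
(everywhere: on the support `0 ≤ f_h ≤ 1` and `‖denominator‖ > e₀4^{h-2}`; off it the value is `0`). -/
theorem klps_norm_singleScale_le (h : ℤ) (p : ℝ × (Fin 2 → ℝ)) :
    ‖bgmSingleScale e₀ μ E h p‖ ≤ (e₀ * (4 : ℝ) ^ (h - 2))⁻¹ := by
  have hlow : 0 < e₀ * (4 : ℝ) ^ (h - 2) := by positivity
  by_cases hp : bgmSingleScale e₀ μ E h p = 0
  · rw [hp, norm_zero]; positivity
  obtain ⟨hD1, -, -, -⟩ := klps_shell_of_singleScale_ne_zero he₀ hE hp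
  have hD0 : 0 < ‖bgmDenom μ E h p‖ := hlow.trans hD1
  have hDh : bgmDenom μ E (h - 1) p = bgmDenom μ E h p := klps_denom_eq hE (h - 1) h p
  rw [bgmSingleScale, norm_div, hDh, Complex.norm_real, Real.norm_eq_abs, klps_shell_eq hE]
  have hs0 : 0 ≤ gnShell 4 e₀ h ‖bgmDenom μ E h p‖ :=
    gnShell_nonneg (by norm_num : (1 : ℝ) < 4) he₀ h (norm_nonneg _)
  have hs1 : gnShell 4 e₀ h ‖bgmDenom μ E h p‖ ≤ 1 := gnShell_le_one 4 e₀ h _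
  rw [abs_of_nonneg hs0, div_le_iff₀ hD0]
  calc gnShell 4 e₀ h ‖bgmDenom μ E h p‖ ≤ 1 := hs1
    _ = (e₀ * (4 : ℝ) ^ (h - 2))⁻¹ * (e₀ * (4 : ℝ) ^ (h - 2)) := by
        rw [inv_mul_cancel₀ hlow.ne']
    _ ≤ (e₀ * (4 : ℝ) ^ (h - 2))⁻¹ * ‖bgmDenom μ E h p‖ :=
        mul_le_mul_of_nonneg_left hD1.le (by positivity)

/-- **The bubble, pointwise** (particle–particle at transfer `q⃗`: lines `k⃗` and `q⃗ - k⃗`; the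
particle–hole bubble at transfer `-q⃗` has the same spatial kinematics). The product of a scale-`h`
and a scale-`h′` free single-scale propagator is bounded by `(e₀4^{h-2})⁻¹ (e₀4^{h′-2})⁻¹` and
vanishes unless `|ε(k⃗) - μ| < e₀4^h` and `|ε(q⃗ - k⃗) - μ| < e₀4^{h′}` — the two-shell set of
Lemma E.1 / E.3 (`kltb_exists_twoShell_bound`, transfer `w = q⃗`). -/
theorem klps_bubble_pointwise (h h' : ℤ) (k₀ k₀' : ℝ) (k q : Fin 2 → ℝ) :
    ‖bgmSingleScale e₀ μ E h (k₀, k) * bgmSingleScale e₀ μ E h' (k₀', q - k)‖ ≤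
        (e₀ * (4 : ℝ) ^ (h - 2))⁻¹ * (e₀ * (4 : ℝ) ^ (h' - 2))⁻¹ ∧
      (bgmSingleScale e₀ μ E h (k₀, k) * bgmSingleScale e₀ μ E h' (k₀', q - k) ≠ 0 →
        |sqDispersion k - μ| < e₀ * (4 : ℝ) ^ h ∧ |sqDispersion (q - k) - μ| < e₀ * (4 : ℝ) ^ h' ∧
          |k₀| < e₀ * (4 : ℝ) ^ h ∧ |k₀'| < e₀ * (4 : ℝ) ^ h') := by
  constructor
  · rw [norm_mul]
    exact mul_le_mul (klps_norm_singleScale_le he₀ hE h (k₀, k))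
      (klps_norm_singleScale_le he₀ hE h' (k₀', q - k)) (norm_nonneg _) (by positivity)
  · intro hne
    have h1 : bgmSingleScale e₀ μ E h (k₀, k) ≠ 0 := left_ne_zero_of_mul hne
    have h2 : bgmSingleScale e₀ μ E h' (k₀', q - k) ≠ 0 := right_ne_zero_of_mul hne
    obtain ⟨-, -, ha, hb⟩ := klps_shell_of_singleScale_ne_zero he₀ hE h1
    obtain ⟨-, -, hc, hd⟩ := klps_shell_of_singleScale_ne_zero he₀ hE h2
    exact ⟨ha, hc, hb, hd⟩

omit he₀ hE in
/-- The spatial kinematics in the coordinates of `…TwoShellBound`: `ε(q⃗ - k⃗) = -2(cos(k₁ - q₁) + cos(k₂ - q₂))`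
(`ε` is even), so the support condition of `klps_bubble_pointwise` is membership of `(k 0, k 1)` in the
two-shell set `{|ε(x) - μ| < ε₁, |ε(x - w) - μ| ≤ ε₂}` with `w = (q 0, q 1)`. -/
theorem klps_sqDispersion_sub (k q : Fin 2 → ℝ) :
    sqDispersion (q - k) = -2 * (Real.cos (k 0 - q 0) + Real.cos (k 1 - q 1)) := by
  rw [sqDispersion_eq_eps2, eps2]
  simp only [Pi.sub_apply]
  rw [← Real.cos_neg (k 0 - q 0), ← Real.cos_neg (k 1 - q 1), neg_sub, neg_sub]

end Main

end Summit.HubbardSuperconductivity.HubbardSuperconductivity.Theorems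

end
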